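import Summits.ValiantsHypothesis.ValiantsHypothesis.Theorems.BarrierLeverChowBenchmarkPairsBlockPeelCertLUP

/-!
# Route BarrierLever — item 22038 `ChowBenchmarkPairs`, line `moore-peel`: the BLOCK PEEL — the FAST data-free certificate kit:
# bit-level tabulation and PACKED-ROW (multi-precision) LU certificates `P · A = L · U` modulo `p`

Helper file (`--supports stmt-ValiantsHypothesis-22038`; cell valiant-natproofs, rung V4, 𝒟-side benchmark of record, line `moore_peel`,
planner SUCCESSOR MANDATE M2 (HOME/STATUS.md l.1824: «kernel-verified FAST checker»); seat val-np-p4 gen 30).  Closes NO item; no certificate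
is checked here.  Third kit after `…BlockPeelCertLU` / `…BlockPeelCertLUP` (p716120 / p716688), whose certificates cost ≈ 0.6 µs per inner
multiply-add in the IR interpreter (`887²` in 554 s) and whose tabulation of the Mathlib block matrix costs ≈ 0.35 ms per entry — too slow
for the gate's 600 s budget from `n ≈ 900` on (p717600, `1145²`, timed out).  Two changes, both with kernel bridges:

* **FAST TABULATION** `fastTable`: attached rows `(T_q, s)` are computed by bit operations — `q &&& B = q`, `popcount`, and binary modular
  powering `powModBin` (kernel: `natCast_powModBin`) — `natCast_fastAtt` proves the entry equals `blockEntry` in `ZMod p`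
  (`bits_subset_bits_iff`, `card_bits` of `…MooreBench`); the `t(t-1)/2` internal pair rows keep the Mathlib evaluation.  Kernel:
  **`flatMat_fastTable`** (the fast table IS the reindexed block matrix).
* **PACKED ROWS**: a row of residues is ONE natural number in base `B = 2^64` (`packBase`); a row operation is one native multi-precision
  `*`/`+` of the Lean runtime, so the interpreter executes `O(n²)` steps instead of `O(n³)`.  `packedLUP` (UNVERIFIED) runs LU with row
  pivoting on packed rows and writes the usual flat `L\U` table; the VERIFIED checker `packCheckP` recomputes `L · U` row by row as
  `Σ_k L[i,k] · pack(U_k)` (native) and compares base-`B` digits with `A[perm[i], j]` modulo `p`.  Kernel: `packRow_eq`, `rowAcc_eq`, the digit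
  lemma `packSum_digit` (no carries as long as `n · p² < B`, a hypothesis discharged by `norm_num` in each certificate), whence
  `luMatL_mul_luMatU_eq_of_packCheckP` (`⇒ L · U = P · A`), **`det_ne_zero_of_packCheckP`** and **`det_blockMatrix_X_ne_zero_of_packCheckP`**
  (symbolic `det J^κ(i,t)(Λ) ≠ 0`), reusing `lupPerm`, `det_luMatL`, `det_luMatU` of the earlier kits.
A certificate file: `def tab := fastTable κ i t n p ptN e`, `def c := packedLUP tab n p`, `theorem chk : packCheckP tab c.1 c.2 n p &&
lupPermCheck c.2 (lupPermInv c.2 n) n = true := by native_decide`, then `det_blockMatrix_X_ne_zero_of_packCheckP … (by norm_num) chk`.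

WHAT THIS IS NOT: nothing is certified in this file; node #1 `stub_segmentMeanValue` (∀ h) untouched; nothing on crux
stmt-ValiantsHypothesis-14610 or on `VP` versus `VNP`.
-/

set_option linter.dupNamespace false

namespace Summit.ValiantsHypothesis.ValiantsHypothesis.Theorems.BarrierLever.MoorePeel

open Finset

/-! ## 1. Binary modular powering -/

/-- `a ^ e mod p` by binary powering (well-founded recursion on `e`). -/
def powModBin (a p : ℕ) (e : ℕ) : ℕ :=
  if h : e = 0 then 1 % p
  else
    let r := powModBin a p (e / 2)
    if e % 2 = 0 then r * r % p else r * r * a % p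
termination_by e
decreasing_by exact Nat.div_lt_self (Nat.pos_of_ne_zero h) one_lt_two

/-- KERNEL: `powModBin a p e ≡ a ^ e` in `ZMod p`. -/
theorem natCast_powModBin (a p : ℕ) : ∀ e : ℕ, ((powModBin a p e : ℕ) : ZMod p) = (a : ZMod p) ^ e := by
  intro e
  induction e using Nat.strong_induction_on with
  | _ e ih =>
    rw [powModBin]
    split_ifs with h0 h2
    · rw [h0, pow_zero, ZMod.natCast_mod, Nat.cast_one]
    · have hlt : e / 2 < e := Nat.div_lt_self (Nat.pos_of_ne_zero h0) one_lt_two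
      have he : e = e / 2 + e / 2 := by omega
      rw [ZMod.natCast_mod, Nat.cast_mul, ih _ hlt, ← pow_add, ← he]
    · have hlt : e / 2 < e := Nat.div_lt_self (Nat.pos_of_ne_zero h0) one_lt_two
      have he : e = e / 2 + e / 2 + 1 := by omega
      rw [ZMod.natCast_mod, Nat.cast_mul, Nat.cast_mul, ih _ hlt, ← pow_add, ← pow_succ, ← he]

/-! ## 2. Fast tabulation of the block matrix -/

/-- The attached-row entry `[T_q ⊆ T_B] · κ(|B|-|q|) · y^{B-q}` modulo `p`, by bit operations. -/
def fastAtt (κ : ℕ → ℕ) (p q B y : ℕ) : ℕ :=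
  if q &&& B = q then κ (popcount B - popcount q) % p * powModBin y p (B - q) % p else 0

/-- KERNEL: the fast attached entry is the block entry. -/
theorem natCast_fastAtt (κ : ℕ → ℕ) (p q B y : ℕ) :
    ((fastAtt κ p q B y : ℕ) : ZMod p) = ((kincl κ q B : ℕ) : ZMod p) * (y : ZMod p) ^ (B - q) := by
  unfold fastAtt kincl
  by_cases hsub : bits q ⊆ bits B
  · rw [if_pos (bits_subset_bits_iff.mp hsub), if_pos hsub, card_bits, card_bits, ZMod.natCast_mod, Nat.cast_mul,
      ZMod.natCast_mod, natCast_powModBin]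
  · rw [if_neg (fun h => hsub (bits_subset_bits_iff.mpr h)), if_neg hsub, Nat.cast_zero, zero_mul]

/-- One entry of the fast table: attached rows by `fastAtt`, internal pair rows by the Mathlib definition (`ZMod.val`). -/
def fastEntryAt (κ : ℕ → ℕ) (i t n p : ℕ) (ptN : Fin t → ℕ) (e : BlockIdx i t ≃ Fin n) (r c : Fin n) : ℕ :=
  if ((e.symm r).2 : ℕ) < i then
    fastAtt κ p (e.symm r).2 (windowStart i + (finSigmaFinEquiv (e.symm c) : ℕ)) (ptN (e.symm r).1)
  else (blockMatrix κ i t (fun s : Fin t => (ptN s : ZMod p)) (e.symm r) (e.symm c)).val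

/-- **The fast flat table** of `reindex e e (J^κ(i,t)(pt))` mod `p` at the natural point `ptN` (`pt s = ptN s`). -/
def fastTable (κ : ℕ → ℕ) (i t n p : ℕ) (ptN : Fin t → ℕ) (e : BlockIdx i t ≃ Fin n) : Array ℕ :=
  Array.ofFn fun idx : Fin (n * n) =>
    fastEntryAt κ i t n p ptN e ⟨idx.val / n, Nat.div_lt_of_lt_mul idx.2⟩
      ⟨idx.val % n, Nat.mod_lt _ (Nat.pos_of_ne_zero fun h => by have := idx.2; simp [h] at this)⟩

/-- KERNEL: reading the fast table. -/
theorem fastTable_getD (κ : ℕ → ℕ) (i t n p : ℕ) (ptN : Fin t → ℕ) (e : BlockIdx i t ≃ Fin n) (r c : Fin n) :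
    (fastTable κ i t n p ptN e).getD (n * r.val + c.val) 0 = fastEntryAt κ i t n p ptN e r c := by
  have hn : 0 < n := Fin.pos r
  have hlt : n * r.val + c.val < n * n := by
    have := r.2; have := c.2; nlinarith
  rw [fastTable, Array.getD_eq_getD_getElem?, Array.getElem?_ofFn, dif_pos hlt, Option.getD_some]
  have e1 : (n * r.val + c.val) / n = r.val := by
    rw [Nat.mul_add_div hn, Nat.div_eq_of_lt c.2, Nat.add_zero]
  have e2 : (n * r.val + c.val) % n = c.val := by
    rw [Nat.mul_add_mod, Nat.mod_eq_of_lt c.2]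
  congr 1
  · exact Fin.ext e1
  · exact Fin.ext e2

/-- **KERNEL: the fast table IS the reindexed block matrix** (as a matrix over `ZMod p`, `NeZero p`). -/
theorem flatMat_fastTable (κ : ℕ → ℕ) (i t n p : ℕ) [NeZero p] (ptN : Fin t → ℕ) (e : BlockIdx i t ≃ Fin n) :
    flatMat p (fastTable κ i t n p ptN e) n =
      Matrix.reindex e e (blockMatrix κ i t (fun s : Fin t => (ptN s : ZMod p))) := by
  ext r c
  rw [flatMat, fastTable_getD, fastEntryAt, Matrix.reindex_apply, Matrix.submatrix_apply]
  split_ifs with hq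
  · rw [natCast_fastAtt, blockMatrix, Matrix.of_apply, blockEntry, if_pos hq]
  · rw [ZMod.natCast_zmod_val]

/-! ## 3. Packed rows -/

/-- The packing base `B = 2^64`. -/
def packBase : ℕ := 18446744073709551616

/-- `B = 2^64`. -/
theorem packBase_eq : packBase = 2 ^ 64 := by norm_num [packBase]

/-- `0 < B`. -/
theorem packBase_pos : 0 < packBase := by norm_num [packBase]

/-- `acc · B^m + Σ_{j<m} (U[k,j] mod p) · B^j` by Horner (most significant digit first). -/
def packRow (lu : Array ℕ) (n p k : ℕ) : ℕ → ℕ → ℕ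
  | 0, acc => acc
  | m + 1, acc => packRow lu n p k m (acc * packBase + luU lu n k m % p)

/-- KERNEL: the Horner loop packs the reduced row of `U`. -/
theorem packRow_eq (lu : Array ℕ) (n p k : ℕ) (m acc : ℕ) :
    packRow lu n p k m acc = acc * packBase ^ m + ∑ j ∈ Finset.range m, (luU lu n k j % p) * packBase ^ j := by
  induction m generalizing acc with
  | zero => simp [packRow]
  | succ m ih =>
    rw [packRow, ih, Finset.sum_range_succ, pow_succ]
    ring

/-- The packed reduced rows of `U`, computed once. -/
def packedU (lu : Array ℕ) (n p : ℕ) : Array ℕ := Array.ofFn fun k : Fin n => packRow lu n p k.val n 0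

/-- KERNEL: reading a packed row of `U`. -/
theorem packedU_getD (lu : Array ℕ) (n p : ℕ) (k : ℕ) (hk : k < n) :
    (packedU lu n p).getD k 0 = ∑ j ∈ Finset.range n, (luU lu n k j % p) * packBase ^ j := by
  rw [packedU, Array.getD_eq_getD_getElem?, Array.getElem?_ofFn, dif_pos hk, Option.getD_some, packRow_eq, zero_mul, zero_add]

/-- `acc + Σ_{k<m} (L[i,k] mod p) · packedU[k]`. -/
def rowAcc (lu pk : Array ℕ) (n p i : ℕ) : ℕ → ℕ → ℕ
  | 0, acc => acc
  | m + 1, acc => rowAcc lu pk n p i m (acc + luL lu n i m % p * pk.getD m 0)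

/-- KERNEL: the row accumulator computes the linear combination of packed rows. -/
theorem rowAcc_eq (lu pk : Array ℕ) (n p i : ℕ) (m acc : ℕ) :
    rowAcc lu pk n p i m acc = acc + ∑ k ∈ Finset.range m, luL lu n i k % p * pk.getD k 0 := by
  induction m generalizing acc with
  | zero => simp [rowAcc]
  | succ m ih => rw [rowAcc, ih, Finset.sum_range_succ]; ring

/-- Base-`B` digit `j` of `x`. -/
def packDigit (x j : ℕ) : ℕ := (x >>> (64 * j)) % packBase

/-- The digit as a quotient and remainder. -/
theorem packDigit_eq (x j : ℕ) : packDigit x j = x / packBase ^ j % packBase := by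
  rw [packDigit, Nat.shiftRight_eq_div_pow, pow_mul, ← packBase_eq]

/-- **The digit lemma**: if every `w j' < B` then digit `j` of `Σ_{j'<m} w j' · B^{j'}` is `w j` (`j < m`). -/
theorem packSum_digit (w : ℕ → ℕ) (m : ℕ) (hw : ∀ j, j < m → w j < packBase) (j : ℕ) (hj : j < m) :
    (∑ j' ∈ Finset.range m, w j' * packBase ^ j') / packBase ^ j % packBase = w j := by
  -- split the sum at `j` and `j+1`
  have hsplit : ∑ j' ∈ Finset.range m, w j' * packBase ^ j' =
      (∑ j' ∈ Finset.range j, w j' * packBase ^ j') + w j * packBase ^ j +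
        packBase ^ (j + 1) * ∑ j' ∈ Finset.range (m - (j + 1)), w (j + 1 + j') * packBase ^ j' := by
    have e : m = (j + 1) + (m - (j + 1)) := by omega
    conv_lhs => rw [e, Finset.sum_range_add, Finset.sum_range_succ]
    congr 1
    rw [Finset.mul_sum]
    refine Finset.sum_congr rfl fun j' _ => ?_
    rw [pow_add]; ring
  -- the low part is `< B^j`
  have hlow : ∑ j' ∈ Finset.range j, w j' * packBase ^ j' < packBase ^ j := by
    have key : ∀ i, i ≤ m → ∑ k ∈ Finset.range i, w k * packBase ^ k < packBase ^ i := by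
      intro i
      induction i with
      | zero => intro _; simp
      | succ i ih =>
        intro hi
        rw [Finset.sum_range_succ]
        have h1 := ih (by omega)
        have h2 : w i + 1 ≤ packBase := hw i (by omega)
        calc ∑ k ∈ Finset.range i, w k * packBase ^ k + w i * packBase ^ i
            < packBase ^ i + w i * packBase ^ i := by omega
          _ = (w i + 1) * packBase ^ i := by ring
          _ ≤ packBase * packBase ^ i := Nat.mul_le_mul_right _ h2
          _ = packBase ^ (i + 1) := by ring
    exact key j (le_of_lt hj)
  rw [hsplit]
  have hBj : 0 < packBase ^ j := Nat.pos_of_ne_zero (pow_ne_zero _ (Nat.ne_of_gt packBase_pos))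
  -- divide by `B^j`
  have hdiv : ((∑ j' ∈ Finset.range j, w j' * packBase ^ j') + w j * packBase ^ j +
      packBase ^ (j + 1) * ∑ j' ∈ Finset.range (m - (j + 1)), w (j + 1 + j') * packBase ^ j') / packBase ^ j =
      w j + packBase * ∑ j' ∈ Finset.range (m - (j + 1)), w (j + 1 + j') * packBase ^ j' := by
    have e : (∑ j' ∈ Finset.range j, w j' * packBase ^ j') + w j * packBase ^ j +
        packBase ^ (j + 1) * ∑ j' ∈ Finset.range (m - (j + 1)), w (j + 1 + j') * packBase ^ j' =
        (∑ j' ∈ Finset.range j, w j' * packBase ^ j') +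
          packBase ^ j * (w j + packBase * ∑ j' ∈ Finset.range (m - (j + 1)), w (j + 1 + j') * packBase ^ j') := by
      rw [pow_succ]; ring
    rw [e, Nat.add_mul_div_left _ _ hBj, Nat.div_eq_of_lt hlow, zero_add]
  rw [hdiv, Nat.add_mul_mod_self_left, Nat.mod_eq_of_lt (hw j hj)]

/-! ## 4. The packed checker -/

/-- **The packed pivoted checker**: for every `i`: `U[i,i] ≢ 0`, and for every `j`: digit `j` of `Σ_k (L[i,k] mod p) · pack(U_k)`
is `≡ A[perm[i], j] (mod p)`. -/
def packCheckP (a lu perm : Array ℕ) (n p : ℕ) : Bool :=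
  let pk := packedU lu n p
  (List.range n).all fun i =>
    (lu.getD (n * i + i) 0 % p != 0) &&
    (let x := rowAcc lu pk n p i n 0
     (List.range n).all fun j => packDigit x j % p == a.getD (n * perm.getD i 0 + j) 0 % p)

/-- Digit `j` of the row accumulator is the exact dot product of the reduced rows. -/
theorem packDigit_rowAcc (lu : Array ℕ) (n p i j : ℕ) (hp : 0 < p) (hB : n * (p * p) < packBase) (hj : j < n) :
    packDigit (rowAcc lu (packedU lu n p) n p i n 0) j = ∑ k ∈ Finset.range n, (luL lu n i k % p) * (luU lu n k j % p) := by
  rw [packDigit_eq, rowAcc_eq, zero_add]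
  -- rewrite the accumulator as a packed sum of the dot products
  have e : ∑ k ∈ Finset.range n, luL lu n i k % p * (packedU lu n p).getD k 0 =
      ∑ j' ∈ Finset.range n, (∑ k ∈ Finset.range n, (luL lu n i k % p) * (luU lu n k j' % p)) * packBase ^ j' := by
    rw [Finset.sum_congr rfl fun k hk => by rw [packedU_getD lu n p k (Finset.mem_range.mp hk), Finset.mul_sum],
      Finset.sum_comm]
    refine Finset.sum_congr rfl fun j' _ => ?_
    rw [Finset.sum_mul]
    refine Finset.sum_congr rfl fun k _ => ?_
    ring
  rw [e]
  refine packSum_digit _ n (fun j' hj' => ?_) j hj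
  -- no carries: each dot product is `< n · p² < B`
  calc ∑ k ∈ Finset.range n, luL lu n i k % p * (luU lu n k j' % p)
      ≤ ∑ k ∈ Finset.range n, p * p := Finset.sum_le_sum fun k _ =>
          Nat.mul_le_mul (Nat.le_of_lt (Nat.mod_lt _ hp)) (Nat.le_of_lt (Nat.mod_lt _ hp))
    _ = n * (p * p) := by rw [Finset.sum_const, Finset.card_range, smul_eq_mul]
    _ < packBase := hB

section Matrices

variable (p : ℕ)

/-- **A passed packed check means `L * U = P * A`** over `ZMod p`. -/
theorem luMatL_mul_luMatU_eq_of_packCheckP [Fact p.Prime] (a lu perm pinv : Array ℕ) (n : ℕ) (hB : n * (p * p) < packBase)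
    (h : packCheckP a lu perm n p = true) (hperm : lupPermCheck perm pinv n = true) :
    luMatL p lu n * luMatU p lu n = (flatMat p a n).submatrix (lupPerm perm pinv n hperm) id := by
  have hp : 0 < p := (Fact.out : p.Prime).pos
  ext i j
  have hrow := List.all_eq_true.mp h i.val (List.mem_range.mpr i.2)
  rw [Bool.and_eq_true] at hrow
  have hij := List.all_eq_true.mp hrow.2 j.val (List.mem_range.mpr j.2)
  rw [beq_iff_eq, packDigit_rowAcc lu n p i.val j.val hp hB j.2] at hij
  rw [Matrix.mul_apply, Matrix.submatrix_apply, flatMat, id, lupPerm_apply]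
  simp only [luMatL, luMatU]
  rw [← (ZMod.natCast_eq_natCast_iff' _ _ p).mpr hij, Nat.cast_sum]
  rw [Fin.sum_univ_eq_sum_range (fun k => (luL lu n i.val k : ZMod p) * (luU lu n k j.val : ZMod p)) n]
  refine Finset.sum_congr rfl fun k _ => ?_
  rw [Nat.cast_mul, ZMod.natCast_mod, ZMod.natCast_mod]

/-- **A passed packed check certifies `det A ≠ 0`** (`p` prime). -/
theorem det_flatMat_ne_zero_of_packCheckP [Fact p.Prime] (a lu perm pinv : Array ℕ) (n : ℕ) (hB : n * (p * p) < packBase)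
    (h : packCheckP a lu perm n p = true) (hperm : lupPermCheck perm pinv n = true) : (flatMat p a n).det ≠ 0 := by
  intro h0
  have e := Matrix.det_permute (lupPerm perm pinv n hperm) (flatMat p a n)
  rw [h0, mul_zero, ← luMatL_mul_luMatU_eq_of_packCheckP p a lu perm pinv n hB h hperm, Matrix.det_mul, det_luMatL,
    one_mul, det_luMatU] at e
  refine absurd e (Finset.prod_ne_zero_iff.mpr fun k _ hk => ?_)
  have hrow := List.all_eq_true.mp h k.val (List.mem_range.mpr k.2)
  rw [Bool.and_eq_true] at hrow
  have hdiag := hrow.1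
  rw [bne_iff_ne, ne_eq] at hdiag
  rw [ZMod.natCast_eq_zero_iff] at hk
  exact hdiag (Nat.mod_eq_zero_of_dvd hk)

end Matrices

/-! ## 5. The (unverified) packed pivoting LU routine -/

/-- Pack row `r` of the flat table `a` (Horner, most significant digit first): `Σ_j (a[r,j] mod p) B^j`. -/
def packTableRow (a : Array ℕ) (n p r : ℕ) : ℕ → ℕ → ℕ
  | 0, acc => acc
  | m + 1, acc => packTableRow a n p r m (acc * packBase + a.getD (n * r + m) 0 % p)

/-- **Candidate LU decomposition with row pivoting on PACKED rows** (unverified): returns the flat `L\U` table of `P · A` and the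
permutation table.  Rows are multi-precision naturals in base `2^64`; eliminations are native `*`/`+`; slots are reduced modulo `p` only
when a row becomes the pivot row (slots stay `< p + n p² < 2^64`). -/
def packedLUP (a0 : Array ℕ) (n p : ℕ) : Array ℕ × Array ℕ := Id.run do
  let mut rows : Array ℕ := Array.ofFn fun r : Fin n => packTableRow a0 n p r.val n 0
  let mut lu : Array ℕ := Array.replicate (n * n) 0
  let mut perm : Array ℕ := Array.range n
  for k in [0:n] do
    -- pivot: first row `r ≥ k` whose slot `k` is nonzero mod `p`
    let mut r := k
    let mut found := false
    for r' in [k:n] do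
      if !found && packDigit (rows.getD r' 0) k % p != 0 then
        r := r'
        found := true
    if r != k then
      let xk := rows.getD k 0
      let xr := rows.getD r 0
      rows := (rows.set! k xr).set! r xk
      let pk := perm.getD k 0
      let pr := perm.getD r 0
      perm := (perm.set! k pr).set! r pk
      -- the multipliers already stored in row positions `k` and `r` of `lu` (columns `< k`) move with the rows
      for j in [0:k] do
        let lk := lu.getD (n * k + j) 0
        let lr := lu.getD (n * r + j) 0
        lu := (lu.set! (n * k + j) lr).set! (n * r + j) lk
    -- reduce the pivot row modulo `p`, store it as row `k` of `U` (columns `≥ k`), re-pack it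
    let x := rows.getD k 0
    let mut acc := 0
    for jj in [0:n] do
      let j := n - 1 - jj
      let d := packDigit x j % p
      let d' := if j < k then 0 else d
      acc := acc * packBase + d'
      if k ≤ j then lu := lu.set! (n * k + j) d'
    rows := rows.set! k acc
    let inv := powModBin (lu.getD (n * k + k) 0) p (p - 2)
    for i in [k+1:n] do
      let d := packDigit (rows.getD i 0) k % p
      let f := d * inv % p
      lu := lu.set! (n * i + k) f
      if f != 0 then
        rows := rows.set! i (rows.getD i 0 + (p - f) * acc)
  return (lu, perm)

/-! ## 6. From a checked packed certificate to the symbolic block determinant -/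

/-- **`det A ≠ 0` from the packed pivoted LU check of ANY table `a` representing `A`** (`flatMat p a n = A`, `p` prime, `n p² < 2^64`). -/
theorem det_ne_zero_of_packCheckP {p : ℕ} [Fact p.Prime] (n : ℕ) (A : Matrix (Fin n) (Fin n) (ZMod p)) (a lu perm pinv : Array ℕ)
    (ha : flatMat p a n = A) (hB : n * (p * p) < packBase) (h : packCheckP a lu perm n p = true)
    (hperm : lupPermCheck perm pinv n = true) : A.det ≠ 0 := by
  rw [← ha]
  exact det_flatMat_ne_zero_of_packCheckP p a lu perm pinv n hB h hperm

/-- **From the FAST table and a checked packed certificate to the symbolic block determinant**: for any weight `κ`, block `(i,t)`, prime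
`p` with `n p² < 2^64`, natural point `ptN`, window-order equivalence `e`, candidate `lu`/`perm`/`pinv`:
`packCheckP (fastTable κ i t n p ptN e) lu perm n p = true ∧ lupPermCheck perm pinv n = true ⇒ det J^κ(i,t)(Λ) ≠ 0` in `ℤ[Λ]`. -/
theorem det_blockMatrix_X_ne_zero_of_packCheckP (κ : ℕ → ℕ) (i t n p : ℕ) [Fact p.Prime] (ptN : Fin t → ℕ)
    (e : BlockIdx i t ≃ Fin n) (lu perm pinv : Array ℕ) (hB : n * (p * p) < packBase)
    (h : packCheckP (fastTable κ i t n p ptN e) lu perm n p = true) (hperm : lupPermCheck perm pinv n = true) :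
    (blockMatrix κ i t (fun s : Fin t => (MvPolynomial.X s : MvPolynomial (Fin t) ℤ))).det ≠ 0 := by
  refine det_blockMatrix_X_ne_zero_of_point κ i t (fun s : Fin t => (ptN s : ZMod p)) ?_
  have := det_ne_zero_of_packCheckP n _ _ lu perm pinv (flatMat_fastTable κ i t n p ptN e) hB h hperm
  rwa [Matrix.det_reindex_self] at this

end Summit.ValiantsHypothesis.ValiantsHypothesis.Theorems.BarrierLever.MoorePeel
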